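import Mathlib
import Summits.FinalStateConjecture.FinalStateConjecture.Theorems.PhotonSphereChannelsRWPotential

/-!
# Route PhotonSphereChannels — far-side asymptotics of the tortoise radius function

Helper file for the far half of `FixedModeChannels` (stmt-FinalStateConjecture-10048). For the
tortoise radius function `r` of the route's linear items (`2M < r`, `r' = 1 − 2M/r`, `r x_c = 3M`)
and `x ≥ x_c`, with `d = x − x_c`:

* `tortoise_le_add` : `r x ≤ d + 3M` (`r' ≤ 1`);
* `tortoise_ge_third` : `3M + d/3 ≤ r x` (`r' ≥ 2/3 − 2M/r ≥ 0` beyond the photon sphere);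
* `tortoise_far_asymptotics` : `0 ≤ (d + 3M) − r x ≤ 6M log(1 + d/(9M))`
  (the defect `(d + 3M) − r` has derivative `2M/r ≤ 6M/(9M + d)`).

So on the far side `r(x) = x − x_c + O(M log((x − x_c)/M))`, which makes the Regge–Wheeler
potential an `O(M log /ρ)`-perturbation of `ℓ(ℓ+1)/(x − x_c)²` at distance `ρ` from the photon
sphere. Elementary (monotonicity from the sign of a derivative).
-/

namespace Summit.FinalStateConjecture.FinalStateConjecture.Theorems

open Real Set Filter Topology

variable {M : ℝ} {r : ℝ → ℝ} {xc : ℝ}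

/-- `r x ≤ (x − x_c) + 3M` for `x ≥ x_c`. -/
theorem tortoise_le_add (hM : 0 < M) (hr : ∀ x, 2 * M < r x)
    (hr' : ∀ x, HasDerivAt r (1 - 2 * M / r x) x) (hxc : r xc = 3 * M) {x : ℝ} (hx : xc ≤ x) :
    r x ≤ (x - xc) + 3 * M := by
  -- `g = r − id` is antitone
  have hg : ∀ y, HasDerivAt (fun y => r y - y) (1 - 2 * M / r y - 1) y := fun y =>
    (hr' y).sub (hasDerivAt_id y)
  have hanti : AntitoneOn (fun y => r y - y) (Ici xc) := by
    refine antitoneOn_of_deriv_nonpos (convex_Ici xc)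
      (fun y _ => (hg y).continuousAt.continuousWithinAt)
      (fun y _ => (hg y).differentiableAt.differentiableWithinAt) fun y _ => ?_
    rw [(hg y).deriv]
    have := hr y
    have : 0 < 2 * M / r y := div_pos (by linarith) (by linarith)
    linarith
  have h := hanti (self_mem_Ici) hx hx
  simp only [hxc] at h
  linarith

/-- `3M + (x − x_c)/3 ≤ r x` for `x ≥ x_c`. -/
theorem tortoise_ge_third (hM : 0 < M) (hr : ∀ x, 2 * M < r x)
    (hr' : ∀ x, HasDerivAt r (1 - 2 * M / r x) x) (hxc : r xc = 3 * M) {x : ℝ} (hx : xc ≤ x) :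
    3 * M + (x - xc) / 3 ≤ r x := by
  have hg : ∀ y, HasDerivAt (fun y => r y - y / 3) (1 - 2 * M / r y - 1 / 3) y := fun y =>
    (hr' y).sub ((hasDerivAt_id y).div_const 3)
  have hmono : MonotoneOn (fun y => r y - y / 3) (Ici xc) := by
    refine monotoneOn_of_deriv_nonneg (convex_Ici xc)
      (fun y _ => (hg y).continuousAt.continuousWithinAt)
      (fun y _ => (hg y).differentiableAt.differentiableWithinAt) fun y hy => ?_
    rw [interior_Ici] at hy
    rw [(hg y).deriv]
    have h3 : 3 * M ≤ r y := (three_mul_le_tortoise_iff hM hr hr' hxc y).2 (le_of_lt hy)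
    have hry : 0 < r y := by linarith [hr y]
    have : 2 * M / r y ≤ 2 / 3 := by
      rw [div_le_div_iff₀ hry (by norm_num)]; linarith
    linarith
  have h := hmono (self_mem_Ici) hx hx
  simp only [hxc] at h
  linarith

/-- **Far-side asymptotics of the tortoise radius function**:
`0 ≤ (x − x_c + 3M) − r x ≤ 6M log(1 + (x − x_c)/(9M))` for `x ≥ x_c`. -/
theorem tortoise_far_asymptotics (hM : 0 < M) (hr : ∀ x, 2 * M < r x)
    (hr' : ∀ x, HasDerivAt r (1 - 2 * M / r x) x) (hxc : r xc = 3 * M) {x : ℝ} (hx : xc ≤ x) :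
    0 ≤ (x - xc + 3 * M) - r x ∧
      (x - xc + 3 * M) - r x ≤ 6 * M * Real.log (1 + (x - xc) / (9 * M)) := by
  refine ⟨by linarith [tortoise_le_add hM hr hr' hxc hx], ?_⟩
  -- `k = (y − x_c + 3M) − r y − 6M log(1 + (y − x_c)/(9M))` is antitone on `[x_c, ∞)`
  have hpos : ∀ y, xc ≤ y → 0 < 1 + (y - xc) / (9 * M) := fun y hy => by
    have : 0 ≤ (y - xc) / (9 * M) := div_nonneg (by linarith) (by linarith)
    linarith
  have hk : ∀ y, xc ≤ y → HasDerivAt (fun y => (y - xc + 3 * M) - r y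
      - 6 * M * Real.log (1 + (y - xc) / (9 * M)))
      ((1 - (1 - 2 * M / r y)) - 6 * M * ((1 / (9 * M)) / (1 + (y - xc) / (9 * M)))) y := by
    intro y hy
    have h1 : HasDerivAt (fun y => y - xc + 3 * M) 1 y := by
      simpa using ((hasDerivAt_id y).sub_const xc).add_const (3 * M)
    have h2 : HasDerivAt (fun y => 1 + (y - xc) / (9 * M)) (1 / (9 * M)) y := by
      have := ((hasDerivAt_id y).sub_const xc).div_const (9 * M)
      simpa using this.const_add 1
    have h3 := (h2.log (hpos y hy).ne').const_mul (6 * M)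
    exact (h1.sub (hr' y)).sub h3
  have hanti : AntitoneOn (fun y => (y - xc + 3 * M) - r y
      - 6 * M * Real.log (1 + (y - xc) / (9 * M))) (Ici xc) := by
    refine antitoneOn_of_deriv_nonpos (convex_Ici xc)
      (fun y hy => (hk y hy).continuousAt.continuousWithinAt)
      (fun y hy => (hk y (interior_subset hy)).differentiableAt.differentiableWithinAt)
      fun y hy => ?_
    rw [interior_Ici] at hy
    have hy' : xc ≤ y := le_of_lt hy
    rw [(hk y hy').deriv]
    have hry := tortoise_ge_third hM hr hr' hxc hy'
    have hr0 : 0 < r y := by linarith [hr y]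
    have hq : 0 < 9 * M + (y - xc) := by linarith
    have e : 6 * M * ((1 / (9 * M)) / (1 + (y - xc) / (9 * M))) = 6 * M / (9 * M + (y - xc)) := by
      field_simp
    rw [e]
    have : 2 * M / r y ≤ 6 * M / (9 * M + (y - xc)) := by
      rw [div_le_div_iff₀ hr0 hq]; nlinarith
    linarith
  have h := hanti (self_mem_Ici) hx hx
  simp only [sub_self, zero_div, add_zero, Real.log_one, mul_zero, sub_zero, hxc] at h
  linarith

end Summit.FinalStateConjecture.FinalStateConjecture.Theorems
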